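import Literature.NumberTheory.LFunctions.Zhang2022.SkeletonPartTwo
import Literature.Analysis.Complex.PerronShiftedSquare
import HarnessLib

/-!
# Zhang (2022) §8: the Perron representations in the proofs of Lemmas 8.2 and 8.4, kernel-checked

Cell `siegel-zhang` (D-0069 width campaign), layer L2, DAG nodes `Z22:§8.u027` and `Z22:(8.9)` of
Y. Zhang, *Discrete mean estimates and the Landau–Siegel zero*, arXiv:2211.02515v1
[Zhang2022LandauSiegel] — **an unrefereed manuscript under adjudication; this file proves two of its
displayed proof steps exactly as printed and asserts nothing about its Theorems 1–2 or about
Landau–Siegel zeros.**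

* `Z22:§8.u027` [Z22 p.45, tex L2349] (proof of Lemma 8.2): "The sum is equal to
  `(1/2πi)∫_{(1)} L(1 − β_j + s, χ) x^s ds/(s − β_μ)²`" — `sum82_eq_perron` (general purely
  imaginary `β, γ`, every modulus, every `x > 0`; an exact identity) and `step8u027`
  (the manuscript's `β_j`, `β_μ` of (2.13), (2.22), §8).
* `Z22:(8.9)` [Z22 p.46, (8.9), tex L2402] (proof of Lemma 8.4): "The sum is equal to
  `(1/2πi)∫_{(1)} (Σ_n χ(n)ξ₀ⱼ(n;d,r) n^{−1−s}) x^s ds/(s + β_μ)²`" — `sum84_eq_perron` /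
  `eq89`, PROVED under the one hypothesis the display silently uses: absolute convergence of the
  Dirichlet series on the line of integration, `Σ_n |ξ₀ⱼ(n;d,r)|/n² < ∞` (typed as a hypothesis,
  not asserted; it is the residual claim of this node).

The typed forms of these two nodes of record are L2-t6's `Typed.S8B.Sum82EqLineIntegral c′` and
`Typed.S8B.Sum84EqLineIntegral c′` (`TypedSection08B`, p412401; `vlineInt 1 F = (1/2π)∫F(1+it)dt`):
`step8u027` is stated in exactly that unfolded shape (every modulus, every `x > 0`), and `eq89` in
the shape of `Sum84EqLineIntegral` with its one extra (unprinted) hypothesis; the one-line bridges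
`sum82EqLineIntegral_holds` etc. are appended once that statement file is in the tree.

Both are instances of the tree's order-two Perron formula with an imaginary shift
(`Literature.Analysis.Complex.integral_dirichletSeries_mul_perronSq_shift`): with `s = 1 + it`,
`(1/2πi)∫_{(1)} F(1+s) x^s ds/(s+ib)² = Σ_{n≤x} (a_n/n)(x/n)^{−ib} log(x/n)`; the printed sums run
over `n < x`, which is the same since the term `n = x` carries `log(x/n) = 0`. Line integrals are
written in the tree's house style `(1/(2π)) ∫ t, F(1 + tI) dt = (1/2πi)∫_{(1)} F(s) ds`.

Not touched here (named residual CLAIMS of `Z22:Lem8.2.pf` / `Z22:Lem8.4.pf`): the contour shifts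
("We move the contour of integration …", `Z22:§8.u028`–`u030` line 1; "moved in the same way",
`Z22:Lem8.4.pf`) and the summability behind (8.9).
-/

noncomputable section

open Complex Real MeasureTheory

namespace Literature.NumberTheory.LFunctions.Zhang2022.Section8PerronSteps

open Literature.NumberTheory.LFunctions.Zhang2022.Skeleton
open Literature.Analysis.Complex

/-! ### Two finite-sum normalisations -/

/-- `Σ_{n<x} f(n) log(x/n) = Σ_{n≤x} f(n) log(x/n)`: the ranges `[1, ⌈x⌉)` and `[1, ⌊x⌋]` differ at
most by the term `n = x`, where `log(x/n) = 0` (`x > 0`). [cite: Zhang2022LandauSiegel, §8 Lemma 8.2] -/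
theorem sum_Ico_ceil_mul_log_eq_sum_Icc_floor (f : ℕ → ℂ) {x : ℝ} (hx : 0 < x) :
    ∑ n ∈ Finset.Ico 1 ⌈x⌉₊, f n * (Real.log (x / n) : ℂ) =
      ∑ n ∈ Finset.Icc 1 ⌊x⌋₊, f n * (Real.log (x / n) : ℂ) := by
  have hsub : Finset.Ico 1 ⌈x⌉₊ ⊆ Finset.Icc 1 ⌊x⌋₊ := by
    intro m hm
    rw [Finset.mem_Ico] at hm
    rw [Finset.mem_Icc]
    exact ⟨hm.1, Nat.le_floor (Nat.lt_ceil.mp hm.2).le⟩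
  apply Finset.sum_subset hsub
  intro m hm hm'
  rw [Finset.mem_Icc] at hm
  rw [Finset.mem_Ico, not_and, not_lt] at hm'
  have hym : x ≤ m := Nat.ceil_le.mp (hm' hm.1)
  have hmy : (m : ℝ) ≤ x := (Nat.le_floor_iff hx.le).mp hm.2
  have hm_eq : (m : ℝ) = x := le_antisymm hmy hym
  have hlog : Real.log (x / m) = 0 := by rw [hm_eq, div_self hx.ne', Real.log_one]
  simp [hlog]

/-- A purely imaginary number is `(Im β)·i`. [folklore] -/
private theorem eq_im_mul_I {β : ℂ} (hβ : β.re = 0) : β = (β.im : ℂ) * I := by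
  apply Complex.ext <;> simp [hβ]

/-- For `n ≥ 1`: `a / n^{1 − β + w} = (a n^{β}) / n^{1 + w}`. [folklore] -/
private theorem div_cpow_one_sub_add (a β w : ℂ) {n : ℕ} (hn : 0 < n) :
    a / (n : ℂ) ^ (1 - β + w) = a * (n : ℂ) ^ β / (n : ℂ) ^ (1 + w) := by
  have hn0 : (n : ℂ) ≠ 0 := by exact_mod_cast hn.ne'
  have e : (1 : ℂ) - β + w = (1 + w) + (-β) := by ring
  rw [e, Complex.cpow_add _ _ hn0, Complex.cpow_neg]
  have hpow : (n : ℂ) ^ β ≠ 0 := Complex.cpow_ne_zero_iff.2 (Or.inl hn0)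
  field_simp

/-- For `n ≥ 1`: `a n^{β} / n = a / n^{1 − β}`. [folklore] -/
private theorem mul_cpow_div_eq_div_cpow_one_sub (a β : ℂ) {n : ℕ} (hn : 0 < n) :
    a * (n : ℂ) ^ β / (n : ℂ) = a / (n : ℂ) ^ (1 - β) := by
  have hn0 : (n : ℂ) ≠ 0 := by exact_mod_cast hn.ne'
  rw [Complex.cpow_sub _ _ hn0, Complex.cpow_one]
  have hpow : (n : ℂ) ^ β ≠ 0 := Complex.cpow_ne_zero_iff.2 (Or.inl hn0)
  field_simp

/-! ### `Z22:§8.u027`: the Perron representation in the proof of Lemma 8.2 -/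

/-- **`Z22:§8.u027`, general form.** For a Dirichlet character `χ (mod D)`, purely imaginary
`β, γ` and real `x > 0`:
`Σ_{1≤m<x} χ(m) m^{−(1−β)} (x/m)^{γ} log(x/m) = (1/2πi)∫_{(1)} L(1 − β + s, χ) x^s ds/(s − γ)²`
(`s = 1 + it`; on the line `Re(1 − β + s) = 2`, `L = Σ χ(m)m^{−(1−β+s)}` converges absolutely and
equals Mathlib's `LFunction`). Exact identity — the order-two Perron formula for the coefficients
`χ(m)m^{β}` with the pole shifted to `s = γ`.
[cite: Zhang2022LandauSiegel, §8 Lemma 8.2 (proof, first display, p.45)] -/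
theorem sum82_eq_perron {D : ℕ} [NeZero D] (χ : DirichletCharacter ℂ D) {β γ : ℂ}
    (hβ : β.re = 0) (hγ : γ.re = 0) {x : ℝ} (hx : 0 < x) :
    ∑ m ∈ Finset.Ico 1 ⌈x⌉₊, χ (m : ZMod D) / (m : ℂ) ^ (1 - β) * ((x / m : ℝ) : ℂ) ^ γ *
        (Real.log (x / m) : ℂ) =
      (1 / (2 * π) : ℂ) * ∫ t : ℝ, χ.LFunction (1 - β + (((1 : ℝ) : ℂ) + t * I)) *
        (x : ℂ) ^ (((1 : ℝ) : ℂ) + t * I) / ((((1 : ℝ) : ℂ) + t * I) - γ) ^ 2 := by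
  obtain ⟨c, rfl⟩ : ∃ c : ℝ, γ = (c : ℂ) * I := ⟨γ.im, eq_im_mul_I hγ⟩
  -- the coefficients `a_m = χ(m) m^{β}`
  have ha : Summable fun m : ℕ => ‖χ (m : ZMod D) * (m : ℂ) ^ β‖ / (m : ℝ) ^ 2 := by
    refine Summable.of_nonneg_of_le (fun m => by positivity) (fun m => ?_)
      (Real.summable_one_div_nat_pow.mpr one_lt_two)
    rcases Nat.eq_zero_or_pos m with rfl | hm
    · simp
    · have h1 : ‖χ (m : ZMod D) * (m : ℂ) ^ β‖ ≤ 1 := by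
        rw [norm_mul, Complex.norm_natCast_cpow_of_pos hm, hβ, Real.rpow_zero, mul_one]
        exact χ.norm_le_one _
      rw [one_div, div_eq_mul_inv]
      exact mul_le_of_le_one_left (by positivity) h1
  -- the integrand is the generic one with `b = −c`
  have hint : ∀ t : ℝ, χ.LFunction (1 - β + (((1 : ℝ) : ℂ) + t * I)) *
      (x : ℂ) ^ (((1 : ℝ) : ℂ) + t * I) / ((((1 : ℝ) : ℂ) + t * I) - c * I) ^ 2 =
      (∑' m : ℕ, (χ (m : ZMod D) * (m : ℂ) ^ β) / (m : ℂ) ^ (1 + (((1 : ℝ) : ℂ) + t * I))) *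
        ((x : ℂ) ^ (((1 : ℝ) : ℂ) + t * I) / ((((1 : ℝ) : ℂ) + t * I) + (-c : ℝ) * I) ^ 2) := by
    intro t
    have hre : 1 < (1 - β + (((1 : ℝ) : ℂ) + t * I)).re := by norm_num [hβ]
    rw [DirichletCharacter.LFunction_eq_LSeries χ hre, LSeries, mul_div_assoc]
    congr 1
    · refine tsum_congr fun m => ?_
      rcases Nat.eq_zero_or_pos m with rfl | hm
      · have h2 : (1 : ℂ) + (((1 : ℝ) : ℂ) + t * I) ≠ 0 := by
          intro h; have := congrArg Complex.re h; simp at this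
        simp only [LSeries.term_zero, Nat.cast_zero]
        rw [Complex.zero_cpow h2]
        simp
      · rw [LSeries.term_of_ne_zero hm.ne', div_cpow_one_sub_add _ _ _ hm]
    · push_cast; ring_nf
  simp_rw [hint]
  rw [integral_dirichletSeries_mul_perronSq_shift ha hx (-c)]
  -- normalise the finite sum
  rw [show ∑ m ∈ Finset.Ico 1 ⌈x⌉₊, χ (m : ZMod D) / (m : ℂ) ^ (1 - β) *
      ((x / m : ℝ) : ℂ) ^ ((c : ℂ) * I) * (Real.log (x / m) : ℂ) =
      ∑ m ∈ Finset.Ico 1 ⌈x⌉₊, (χ (m : ZMod D) / (m : ℂ) ^ (1 - β) *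
      ((x / m : ℝ) : ℂ) ^ ((c : ℂ) * I)) * (Real.log (x / m) : ℂ) from rfl,
    sum_Ico_ceil_mul_log_eq_sum_Icc_floor _ hx]
  have h2π : (1 / (2 * π) : ℂ) * (2 * π) = 1 := by
    have : (π : ℂ) ≠ 0 := by exact_mod_cast Real.pi_pos.ne'
    field_simp
  rw [← mul_assoc, h2π, one_mul]
  refine Finset.sum_congr rfl fun m hm => ?_
  obtain ⟨hm1, -⟩ := Finset.mem_Icc.1 hm
  have hneg : -(((-c : ℝ) : ℂ) * I) = (c : ℂ) * I := by push_cast; ring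
  rw [hneg, mul_cpow_div_eq_div_cpow_one_sub _ _ hm1]
  ring

/-- `β_j` is purely imaginary (`β_j = i b_j`, (2.13)). [cite: Zhang2022LandauSiegel, §2 (2.13)] -/
theorem betaJ_re (c' : ℝ) (D : ℕ) (j : ℕ) : (betaJ c' D j).re = 0 := by
  unfold betaJ beta1 beta2 beta3
  split_ifs <;> simp

/-- `β_μ` is purely imaginary (`β₆ = 3iα/2`, `β₇ = 5iα/2`, (2.22)). [cite: Zhang2022LandauSiegel, §2 (2.22)] -/
theorem betaMu_re (D : ℕ) (μ : ℕ) : (betaMu D μ).re = 0 := by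
  unfold betaMu beta6 beta7
  split_ifs <;> simp

/-- **`Z22:§8.u027` as printed** [Z22 p.45, tex L2349], proof of Lemma 8.2: "The sum is equal to
`(1/2πi)∫_{(1)} L(1 − β_j + s, χ) x^s ds/(s − β_μ)²`", for the sum
`Σ_{m<x} χ(m)m^{−(1−β_j)}(x/m)^{β_μ}log(x/m)` of Lemma 8.2 (typed as in `Skeleton.Lemma82`), the
manuscript's shifts `β_j` (any `j`, convention `β₄ = β₁, β₅ = β₂`) and `β_μ` (`μ = 6, 7`), every
modulus `D` and every `x > 0`. DISCHARGED (exact identity, no hypothesis).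
[cite: Zhang2022LandauSiegel, §8 Lemma 8.2 (proof), p.45] -/
theorem step8u027 (c' : ℝ) {D : ℕ} [NeZero D] (χ : DirichletCharacter ℂ D) (j μ : ℕ) {x : ℝ}
    (hx : 0 < x) :
    ∑ m ∈ Finset.Ico 1 ⌈x⌉₊, χ (m : ZMod D) / (m : ℂ) ^ (1 - betaJ c' D j) *
        ((x / m : ℝ) : ℂ) ^ betaMu D μ * (Real.log (x / m) : ℂ) =
      (1 / (2 * π) : ℂ) * ∫ t : ℝ, χ.LFunction (1 - betaJ c' D j + (((1 : ℝ) : ℂ) + t * I)) *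
        (x : ℂ) ^ (((1 : ℝ) : ℂ) + t * I) / ((((1 : ℝ) : ℂ) + t * I) - betaMu D μ) ^ 2 :=
  sum82_eq_perron χ (betaJ_re c' D j) (betaMu_re D μ) hx

/-! ### `Z22:(8.9)`: the Perron representation in the proof of Lemma 8.4 -/

/-- **`Z22:(8.9)`, general form.** For a Dirichlet character `χ (mod D)`, any coefficients
`ξ : ℕ → ℂ` with `Σ_n |χ(n)ξ(n)|/n² < ∞`, purely imaginary `γ` and real `x > 0`:
`Σ_{1≤n<x} χ(n)ξ(n) n⁻¹ (x/n)^{−γ} log(x/n) = (1/2πi)∫_{(1)} (Σ_n χ(n)ξ(n)n^{−(1+s)}) x^s ds/(s+γ)²`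
(`s = 1 + it`). Exact identity under absolute convergence.
[cite: Zhang2022LandauSiegel, §8 (8.9), p.46] -/
theorem sum84_eq_perron {D : ℕ} [NeZero D] (χ : DirichletCharacter ℂ D) (ξ : ℕ → ℂ)
    (hξ : Summable fun n : ℕ => ‖χ (n : ZMod D) * ξ n‖ / (n : ℝ) ^ 2) {γ : ℂ} (hγ : γ.re = 0)
    {x : ℝ} (hx : 0 < x) :
    ∑ n ∈ Finset.Ico 1 ⌈x⌉₊, χ (n : ZMod D) * ξ n / (n : ℂ) * ((x / n : ℝ) : ℂ) ^ (-γ) *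
        (Real.log (x / n) : ℂ) =
      (1 / (2 * π) : ℂ) * ∫ t : ℝ,
        (∑' n : ℕ, χ (n : ZMod D) * ξ n * (n : ℂ) ^ (-(1 + (((1 : ℝ) : ℂ) + t * I)))) *
          (x : ℂ) ^ (((1 : ℝ) : ℂ) + t * I) / ((((1 : ℝ) : ℂ) + t * I) + γ) ^ 2 := by
  obtain ⟨c, rfl⟩ : ∃ c : ℝ, γ = (c : ℂ) * I := ⟨γ.im, eq_im_mul_I hγ⟩
  have hint : ∀ t : ℝ, (∑' n : ℕ, χ (n : ZMod D) * ξ n * (n : ℂ) ^ (-(1 + (((1 : ℝ) : ℂ) + t * I)))) *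
        (x : ℂ) ^ (((1 : ℝ) : ℂ) + t * I) / ((((1 : ℝ) : ℂ) + t * I) + c * I) ^ 2 =
      (∑' n : ℕ, (χ (n : ZMod D) * ξ n) / (n : ℂ) ^ (1 + (((1 : ℝ) : ℂ) + t * I))) *
        ((x : ℂ) ^ (((1 : ℝ) : ℂ) + t * I) / ((((1 : ℝ) : ℂ) + t * I) + (c : ℝ) * I) ^ 2) := by
    intro t
    rw [mul_div_assoc]
    congr 1
    refine tsum_congr fun n => ?_
    rw [Complex.cpow_neg, div_eq_mul_inv]
  simp_rw [hint]
  rw [integral_dirichletSeries_mul_perronSq_shift hξ hx c]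
  rw [show ∑ n ∈ Finset.Ico 1 ⌈x⌉₊, χ (n : ZMod D) * ξ n / (n : ℂ) *
      ((x / n : ℝ) : ℂ) ^ (-((c : ℂ) * I)) * (Real.log (x / n) : ℂ) =
      ∑ n ∈ Finset.Ico 1 ⌈x⌉₊, (χ (n : ZMod D) * ξ n / (n : ℂ) *
      ((x / n : ℝ) : ℂ) ^ (-((c : ℂ) * I))) * (Real.log (x / n) : ℂ) from rfl,
    sum_Ico_ceil_mul_log_eq_sum_Icc_floor _ hx]
  have h2π : (1 / (2 * π) : ℂ) * (2 * π) = 1 := by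
    have : (π : ℂ) ≠ 0 := by exact_mod_cast Real.pi_pos.ne'
    field_simp
  rw [← mul_assoc, h2π, one_mul]
  refine Finset.sum_congr rfl fun n _ => ?_
  push_cast
  ring

/-- **`Z22:(8.9)` as printed** [Z22 p.46, (8.9), tex L2402], proof of Lemma 8.4: "The sum is equal
to `(1/2πi)∫_{(1)} (Σ_n χ(n)ξ₀ⱼ(n;d,r)n^{−(1+s)}) x^s ds/(s + β_μ)²`", for the sum
`Σ_{n<x} χ(n)ξ₀ⱼ(n;d,r)n⁻¹(x/n)^{−β_μ}log(x/n)` of Lemma 8.4 (typed as in `Skeleton.Lemma84`), the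
manuscript's `ξ₀ⱼ(n;d,r)` (`Skeleton.xiZero`) and `β_μ`, every modulus, every `d, r`, every `x > 0`
— PROVED under the hypothesis `Σ_n |χ(n)ξ₀ⱼ(n;d,r)|/n² < ∞` (absolute convergence of the
Dirichlet series on the line `Re = 2`, which the display presupposes; NOT asserted here — it is the
residual claim of this node). [cite: Zhang2022LandauSiegel, §8 (8.9), p.46] -/
theorem eq89 (c' : ℝ) {D : ℕ} [NeZero D] (χ : DirichletCharacter ℂ D) (j μ d r : ℕ)
    (hξ : Summable fun n : ℕ => ‖χ (n : ZMod D) * xiZero c' D j n d r‖ / (n : ℝ) ^ 2)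
    {x : ℝ} (hx : 0 < x) :
    ∑ n ∈ Finset.Ico 1 ⌈x⌉₊, χ (n : ZMod D) * xiZero c' D j n d r / (n : ℂ) *
        ((x / n : ℝ) : ℂ) ^ (-betaMu D μ) * (Real.log (x / n) : ℂ) =
      (1 / (2 * π) : ℂ) * ∫ t : ℝ,
        (∑' n : ℕ, χ (n : ZMod D) * xiZero c' D j n d r * (n : ℂ) ^ (-(1 + (((1 : ℝ) : ℂ) + t * I)))) *
          (x : ℂ) ^ (((1 : ℝ) : ℂ) + t * I) / ((((1 : ℝ) : ℂ) + t * I) + betaMu D μ) ^ 2 :=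
  sum84_eq_perron χ (fun n => xiZero c' D j n d r) hξ (betaMu_re D μ) hx

end Literature.NumberTheory.LFunctions.Zhang2022.Section8PerronSteps
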